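import Summits.BirchSwinnertonDyer.BirchSwinnertonDyer.Theorems.SmallImageMuTransferMuTransferX9CentralScalar
import Literature.NumberTheory.EllipticCurves.GaloisActionProofs
import Literature.NumberTheory.GaloisRepresentations.EulerSystem
import Literature.NumberTheory.GaloisRepresentations.AbsGaloisGroupCompact
import HarnessLib

set_option autoImplicit false

-- the summit and its single problem are both named `BirchSwinnertonDyer` (registry layout D-0017)
set_option linter.dupNamespace false

/-!
# The depth element at level `p^k`: for `n ≥ n₁(E, p, k, κ)` some `σ ∈ ker ρ_{E,p^k}` lies in `Gal(ℚ̄/ℚ_n) ∖ Gal(ℚ̄/ℚ_{n+1})`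
# — the threshold `N₁` of `stub_kolyvaginPrimePkX9` (line `graded_euler_loss`, skeleton v3)

Seat `bsd-line-k6-p4` (prover-bsd-line-k6-p4-g4-0, 4th LEAD on crux stmt-BirchSwinnertonDyer-20547).  THEOREMS ONLY, sorry-free,
no definition, nothing asserted about any curve beyond what the kernel proves.  `--supports stmt-BirchSwinnertonDyer-20547`.

At level `p` the tree has the depth element at EVERY `n` (`exists_mem_ker_inf_layerSubgroup_not_mem_layerSubgroup_succ`, from
the joint surjectivity `(ρ̄, κ) : Γ_ℚ ↠ Ḡ × ℤ_p`).  At level `p^k` joint surjectivity fails in general (`ℚ(E[p^k]) ∩ ℚ_∞ = ℚ_{n₁}`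
may be non-trivial), and the correct statement has a THRESHOLD: `κ(ker ρ_{E,p^k})` is a subgroup of `ℤ_p` of finite index
(`ker ρ_{E,p^k}` is open — `isOpen_ker_galoisRepTorsion_holds` — in the compact `Γ`, and `κ` is onto), hence contains
`p^{n₁}ℤ_p`; so for every `n ≥ n₁` there is `σ` with `ρ_{E,p^k}(σ) = 1` and `κ(σ) = p^n` exactly.  This is the `N₁` of the
registered stub `stub_kolyvaginPrimePkX9` (Chebotarev at `p`-level `k = d+1` with depth exactly `N ≥ N₁`, MEMO-es §15 STEP 2:
«`m₀ − 1 ≥ d + n₁`, `p^{n₁} = [ℚ(E[p^{d+1}]) ∩ ℚ(μ_{p^∞}) : ℚ(μ_p)]`»).  Pure group theory over the tree's `ZpExtension`;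
any field `F`, any `n : ℤ`, `n ≠ 0` in place of `p^k`.

* `exists_pow_mem_map_of_finiteIndex` — in a commutative group, `g^{[G:S]} ∈ S` for a finite-index subgroup `S`;
* `exists_threshold_ofAdd_pow_mem_map_kerSubgroup` — `∃ n₁, ∀ n ≥ n₁, p^n ∈ κ(H)` for any open subgroup `H ≤ Γ_F`;
* `exists_threshold_mem_ker_inf_layerSubgroup_not_mem_succ` — the depth element in `ker ρ_{E,n₀}` (`n₀ ≠ 0`), `W` elliptic.

References: J.-P. Serre, Invent. Math. 15 (1972) §2.4 Prop. 15 [Serre1972]; L. C. Washington, GTM 83, §13.1 [Washington1997];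
HOME/MEMO-es.md §15 STEP 2.
-/

noncomputable section

open Field WeierstrassCurve Literature.NumberTheory.EllipticCurves Literature.NumberTheory.GaloisRepresentations Function

namespace Summit.BirchSwinnertonDyer.BirchSwinnertonDyer.Theorems.OneSidedTwistSqueezeX9KatoDivisibilityX9DepthElementPk

/-! ## §1 Group theory: finite-index subgroups of `ℤ_p` contain `p^{n₁}ℤ_p` -/

section Group

/-- In a commutative group, `g ^ [G : S] ∈ S` for every subgroup `S` of finite index (the quotient has order `[G:S]`).
[folklore] -/
theorem pow_index_mem_of_comm {G : Type*} [CommGroup G] (S : Subgroup G) (g : G) : g ^ S.index ∈ S := by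
  rw [← QuotientGroup.eq_one_iff, QuotientGroup.mk_pow, Subgroup.index]
  exact pow_card_eq_one'

variable {p : ℕ} [Fact p.Prime]

/-- A natural number `M ≠ 0` is `p^a` times a `p`-ADIC UNIT: `(M : ℤ_p) = p^a · u`. [folklore] -/
theorem exists_natCast_eq_pow_mul_unit {M : ℕ} (hM : M ≠ 0) :
    ∃ (a : ℕ) (u : ℤ_[p]ˣ), (M : ℤ_[p]) = (p : ℤ_[p]) ^ a * u := by
  have hp : p.Prime := Fact.out
  obtain ⟨a, m, hm, rfl⟩ := Nat.exists_eq_pow_mul_and_not_dvd hM p hp.ne_one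
  have hunit : IsUnit ((m : ℤ) : ℤ_[p]) := by
    rw [PadicInt.isUnit_iff]
    have hle : ‖((m : ℤ) : ℤ_[p])‖ ≤ 1 := PadicInt.norm_le_one _
    have hlt : ¬ ‖((m : ℤ) : ℤ_[p])‖ < 1 := by
      rw [PadicInt.norm_int_lt_one_iff_dvd]
      exact_mod_cast hm
    exact le_antisymm hle (not_lt.mp hlt)
  obtain ⟨u, hu⟩ := hunit
  refine ⟨a, u, ?_⟩
  rw [Nat.cast_mul, Nat.cast_pow, hu, Int.cast_natCast]

/-- **A finite-index subgroup of `(ℤ_p, +)` (written multiplicatively) contains `p^n` for all large `n`.** [folklore] -/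
theorem exists_threshold_ofAdd_pow_mem (S : Subgroup (Multiplicative ℤ_[p])) [S.FiniteIndex] :
    ∃ n₁ : ℕ, ∀ n : ℕ, n₁ ≤ n → Multiplicative.ofAdd ((p : ℤ_[p]) ^ n) ∈ S := by
  obtain ⟨a, u, hu⟩ := exists_natCast_eq_pow_mul_unit (p := p) (Subgroup.FiniteIndex.index_ne_zero (H := S))
  refine ⟨a, fun n hn => ?_⟩
  -- `p^n = [ℤ_p : S] · (p^{n−a} u⁻¹)`
  have hmem := pow_index_mem_of_comm S (Multiplicative.ofAdd ((p : ℤ_[p]) ^ (n - a) * ↑u⁻¹))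
  have heq : (Multiplicative.ofAdd ((p : ℤ_[p]) ^ (n - a) * ↑u⁻¹)) ^ S.index =
      Multiplicative.ofAdd ((p : ℤ_[p]) ^ n) := by
    rw [← ofAdd_nsmul, nsmul_eq_mul, hu]
    congr 1
    calc (p : ℤ_[p]) ^ a * ↑u * ((p : ℤ_[p]) ^ (n - a) * ↑u⁻¹)
        = (p : ℤ_[p]) ^ a * (p : ℤ_[p]) ^ (n - a) * (↑u * ↑u⁻¹) := by ring
      _ = (p : ℤ_[p]) ^ n := by rw [Units.mul_inv, mul_one, ← pow_add, Nat.add_sub_cancel' hn]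
  rw [heq] at hmem
  exact hmem

end Group

/-! ## §2 The depth element in an open subgroup, and in `ker ρ_{E,n₀}` -/

section Depth

universe u

variable {F : Type u} [Field F] {p : ℕ} [Fact p.Prime] (κ : ZpExtension F p)

/-- **For an OPEN subgroup `H ≤ Γ_F`: `∃ n₁, ∀ n ≥ n₁, ∃ σ ∈ H` with `κ σ = p^n`** (so `σ ∈ Gal(F̄/F_n) ∖ Gal(F̄/F_{n+1})`):
`κ(H)` has finite index in `ℤ_p` (`H` has finite index in the compact `Γ_F`, `κ` is onto). [cite: Washington1997, §13.1] -/
theorem exists_threshold_mem_and_apply_eq (H : Subgroup (absoluteGaloisGroup F)) (hH : IsOpen (H : Set (absoluteGaloisGroup F))) :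
    ∃ n₁ : ℕ, ∀ n : ℕ, n₁ ≤ n → ∃ σ ∈ H, κ σ = Multiplicative.ofAdd ((p : ℤ_[p]) ^ n) := by
  haveI : CompactSpace (absoluteGaloisGroup F) := absoluteGaloisGroup_compactSpace F
  haveI : H.FiniteIndex := finiteIndex_of_isOpen_of_compactSpace H hH
  let S : Subgroup (Multiplicative ℤ_[p]) := H.map κ.toContinuousMonoidHom.toMonoidHom
  haveI : S.FiniteIndex := by
    refine ⟨fun h0 => Subgroup.FiniteIndex.index_ne_zero (H := H) ?_⟩
    exact Nat.eq_zero_of_zero_dvd (h0 ▸ Subgroup.index_map_dvd H κ.surjective)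
  obtain ⟨n₁, hn₁⟩ := exists_threshold_ofAdd_pow_mem S
  refine ⟨n₁, fun n hn => ?_⟩
  obtain ⟨σ, hσ, hκσ⟩ := Subgroup.mem_map.mp (hn₁ n hn)
  exact ⟨σ, hσ, hκσ⟩

variable (W : WeierstrassCurve F) [W.IsElliptic]

/-- **The depth element at level `n₀` (e.g. `n₀ = p^k`).**  For `W` elliptic, `n₀ ≠ 0` and any `ℤ_p`-extension `κ` of `F`:
there is `n₁` such that for every `n ≥ n₁` some `σ ∈ ker ρ_{E,n₀} ⊓ Gal(F̄/F_n)` has `σ ∉ Gal(F̄/F_{n+1})` (indeed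
`κ σ = p^n`).  The threshold `N₁` of `stub_kolyvaginPrimePkX9` (at `n₀ = p^{d+1}`); at `n₀ = p` with `F = ℚ`, `E[p]`
irreducible and `ρ̄` not surjective the tree has it for every `n`. [cite: Serre1972, §2.4 Prop. 15] [cite: Washington1997, §13.1] -/
theorem exists_threshold_mem_ker_inf_layerSubgroup_not_mem_succ {n₀ : ℤ} (hn₀ : n₀ ≠ 0) :
    ∃ n₁ : ℕ, ∀ n : ℕ, n₁ ≤ n →
      ∃ σ ∈ (galoisRepTorsion W n₀).ker ⊓ κ.layerSubgroup n,
        κ σ = Multiplicative.ofAdd ((p : ℤ_[p]) ^ n) ∧ σ ∉ κ.layerSubgroup (n + 1) := by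
  obtain ⟨n₁, hn₁⟩ := exists_threshold_mem_and_apply_eq κ (galoisRepTorsion W n₀).ker
    (W.isOpen_ker_galoisRepTorsion_holds hn₀)
  have hp : Prime (p : ℤ_[p]) := PadicInt.prime_p
  refine ⟨n₁, fun n hn => ?_⟩
  obtain ⟨σ, hσ, hκσ⟩ := hn₁ n hn
  refine ⟨σ, Subgroup.mem_inf.mpr ⟨hσ, ?_⟩, hκσ, ?_⟩
  · rw [ZpExtension.mem_layerSubgroup, hκσ, toAdd_ofAdd]
  · rw [ZpExtension.mem_layerSubgroup, hκσ, toAdd_ofAdd, pow_dvd_pow_iff hp.ne_zero hp.not_unit]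
    omega

end Depth

end Summit.BirchSwinnertonDyer.BirchSwinnertonDyer.Theorems.OneSidedTwistSqueezeX9KatoDivisibilityX9DepthElementPk

end
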